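import Mathlib.Order.Bounds.Basic
import Mathlib.Data.Int.LeastGreatest
import Mathlib.Algebra.BigOperators.Group.Finset.Basic
import Literature.Probability.LatticeModels.MeshCells
import HarnessLib

/-!
# Windows of a mesh column and the decomposition of rung counts

Topic: Probability / LatticeModels (sixth file of the "bulk = largest mesh component for every
Jordan domain" theorem; sub-namespace `…LatticeModels.Mesh`). For a bounded `Ω`, mesh `δ > 0` and
a column `k`, every height `j` sits in a unique **window** `(b, t]`: `b < j ≤ t`, the cells
`(k, b)` and `(k, t)` are not perfect and all cells strictly between them are perfect
(`exists_window`, `window_eq_of_mem`); far cells are not even full, so windows exist. The rungs of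
column `k` traversed by a lattice walk are then counted window by window
(`countP_isKRung_eq_sum`): a finite sum, over the bottoms `b` of the windows met, of the numbers of
traversed rungs `j'` with `b < j' ≤ t(b)` — the quantity shown to be even, window by window, in
`MeshStrayParity.lean`.

Folklore bookkeeping. Mathlib anchors: `Int.exists_greatest_of_bdd`, `Int.exists_least_of_bdd`,
`List.countP`, `Finset.sum`. H21 anchors: `Mesh.IsPerfect`, `Mesh.IsFull`, `Mesh.rung`,
`Mesh.IsKRung`, `Mesh.mul_abs_le_of_isFull` (`MeshCells.lean`, `MeshColumns.lean`).
-/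

namespace Literature.Probability.LatticeModels.Mesh

open Set Metric

noncomputable section

variable {Ω : Set ℂ} {δ : ℝ}

/-! ### Far cells, and the window of a height -/

/-- In a bounded `Ω`, below every height there is a non-perfect cell of column `k` (`δ > 0`).
[folklore] -/
theorem exists_lt_not_isPerfect (hΩb : Bornology.IsBounded Ω) (hδ : 0 < δ) (k j : ℤ) :
    ∃ i, i < j ∧ ¬ IsPerfect Ω δ k i := by
  obtain ⟨R, hR⟩ := (Metric.isBounded_iff_subset_closedBall (0 : ℂ)).1 hΩb
  refine ⟨min (j - 1) (-(⌈(R + δ) / δ⌉ + 1)), by omega, fun h => ?_⟩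
  have h1 := (mul_abs_le_of_isFull hδ hR h.1).1
  set i := min (j - 1) (-(⌈(R + δ) / δ⌉ + 1)) with hi
  have hi' : (i : ℝ) ≤ -(⌈(R + δ) / δ⌉ + 1 : ℤ) := by exact_mod_cast min_le_right _ _
  have hceil : (R + δ) / δ ≤ ⌈(R + δ) / δ⌉ := Int.le_ceil _
  have hneg : (i : ℝ) < 0 := by
    have : (0 : ℝ) ≤ (R + δ) / δ := by
      have hR0 : 0 ≤ R + δ := by
        have := mul_nonneg hδ.le (abs_nonneg (i : ℝ)); linarith
      positivity
    push_cast at hi'; linarith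
  rw [abs_of_neg hneg] at h1
  have : δ * ((R + δ) / δ + 1) ≤ δ * (-(i : ℝ)) := by
    apply mul_le_mul_of_nonneg_left _ hδ.le
    push_cast at hi'; linarith
  rw [mul_add, mul_div_cancel₀ _ hδ.ne', mul_one] at this
  linarith

/-- In a bounded `Ω`, at or above every height there is a non-perfect cell of column `k`
(`δ > 0`). [folklore] -/
theorem exists_ge_not_isPerfect (hΩb : Bornology.IsBounded Ω) (hδ : 0 < δ) (k j : ℤ) :
    ∃ i, j ≤ i ∧ ¬ IsPerfect Ω δ k i := by
  obtain ⟨R, hR⟩ := (Metric.isBounded_iff_subset_closedBall (0 : ℂ)).1 hΩb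
  refine ⟨max j (⌈(R + δ) / δ⌉ + 1), le_max_left _ _, fun h => ?_⟩
  have h1 := (mul_abs_le_of_isFull hδ hR h.1).1
  set i := max j (⌈(R + δ) / δ⌉ + 1) with hi
  have hi' : ((⌈(R + δ) / δ⌉ + 1 : ℤ) : ℝ) ≤ i := by exact_mod_cast le_max_right _ _
  have hceil : (R + δ) / δ ≤ ⌈(R + δ) / δ⌉ := Int.le_ceil _
  have hR0 : 0 ≤ R + δ := by
    have := mul_nonneg hδ.le (abs_nonneg (i : ℝ)); linarith
  have hpos : (0 : ℝ) < i := by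
    have : (0 : ℝ) ≤ (R + δ) / δ := by positivity
    push_cast at hi'; linarith
  rw [abs_of_pos hpos] at h1
  have : δ * ((R + δ) / δ + 1) ≤ δ * (i : ℝ) := by
    apply mul_le_mul_of_nonneg_left _ hδ.le
    push_cast at hi'; linarith
  rw [mul_add, mul_div_cancel₀ _ hδ.ne', mul_one] at this
  linarith

/-- **The window of a height.** For every `j` there are `b < j ≤ t` with the cells `(k, b)` and
`(k, t)` not perfect and all cells `(k, i)`, `b < i < t`, perfect. [folklore] -/
theorem exists_window (hΩb : Bornology.IsBounded Ω) (hδ : 0 < δ) (k j : ℤ) :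
    ∃ b t : ℤ, b < j ∧ j ≤ t ∧ ¬ IsPerfect Ω δ k b ∧ ¬ IsPerfect Ω δ k t ∧
      ∀ i, b < i → i < t → IsPerfect Ω δ k i := by
  classical
  -- greatest non-perfect below `j`
  obtain ⟨b, ⟨hbj, hbP⟩, hbmax⟩ := Int.exists_greatest_of_bdd (P := fun i => i < j ∧ ¬ IsPerfect Ω δ k i)
    ⟨j, fun i hi => hi.1.le⟩ (exists_lt_not_isPerfect hΩb hδ k j)
  -- least non-perfect at or above `j`
  obtain ⟨t, ⟨hjt, htP⟩, htmin⟩ := Int.exists_least_of_bdd (P := fun i => j ≤ i ∧ ¬ IsPerfect Ω δ k i)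
    ⟨j, fun i hi => hi.1⟩ (exists_ge_not_isPerfect hΩb hδ k j)
  refine ⟨b, t, hbj, hjt, hbP, htP, fun i hbi hit => ?_⟩
  by_contra hi
  rcases lt_or_ge i j with hij | hij
  · exact absurd (hbmax i ⟨hij, hi⟩) (by omega)
  · exact absurd (htmin i ⟨hij, hi⟩) (by omega)

/-- **Windows are determined by any height they contain.** If `(b, t)` is a window (non-perfect
ends, perfect strictly inside) and `(b', t')` another, and some height lies in both
(`b < j ≤ t`, `b' < j ≤ t'`), then they coincide. [folklore] -/
theorem window_eq_of_mem {k b t b' t' j : ℤ} (hb : ¬ IsPerfect Ω δ k b) (ht : ¬ IsPerfect Ω δ k t)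
    (hin : ∀ i, b < i → i < t → IsPerfect Ω δ k i) (hb' : ¬ IsPerfect Ω δ k b')
    (ht' : ¬ IsPerfect Ω δ k t') (hin' : ∀ i, b' < i → i < t' → IsPerfect Ω δ k i)
    (h1 : b < j) (h2 : j ≤ t) (h1' : b' < j) (h2' : j ≤ t') : b = b' ∧ t = t' := by
  constructor
  · by_contra hne
    rcases lt_or_gt_of_ne hne with h | h
    · exact hb' (hin b' h (by omega))
    · exact hb (hin' b h (by omega))
  · by_contra hne
    rcases lt_or_gt_of_ne hne with h | h
    · exact ht (hin' t (by omega) h)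
    · exact ht' (hin t' (by omega) h)

/-! ### Decomposing the rung count of a walk by windows -/

/-- Rungs of a column are determined by their height. [folklore] -/
theorem rung_injective (k : ℤ) : Function.Injective (rung k) := by
  intro j j' h
  rw [rung, rung, Sym2.eq_iff] at h
  rcases h with ⟨h1, -⟩ | ⟨h1, -⟩
  · have := congrFun h1 1; simpa [corner] using this
  · have := congrFun h1 1; simpa [corner] using this

open Classical in
/-- **Counting rungs window by window.** Let `key : ℤ → ℤ` assign to each height the bottom of its
window (any function will do here) and let `B` be a finite set of integers containing the keys
of the heights of all rungs of column `k` in the list `L`. Then the number of rungs of column `k`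
in `L` is the sum over `b ∈ B` of the numbers of rungs `rung k j` in `L` with `key j = b`.
[folklore] -/
theorem countP_isKRung_eq_sum (k : ℤ) (key : ℤ → ℤ) (B : Finset ℤ) (L : List (Sym2 (Site 2)))
    (hB : ∀ e ∈ L, ∀ j, e = rung k j → key j ∈ B) :
    L.countP (fun e => decide (IsKRung k e)) =
      ∑ b ∈ B, L.countP fun e => decide (∃ j, e = rung k j ∧ key j = b) := by
  induction L with
  | nil => simp
  | cons e L ih =>
    have hB' : ∀ e ∈ L, ∀ j, e = rung k j → key j ∈ B := fun e he => hB e (List.mem_cons_of_mem _ he)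
    rw [List.countP_cons, ih hB']
    simp only [List.countP_cons]
    rw [Finset.sum_add_distrib]
    congr 1
    by_cases hr : IsKRung k e
    · obtain ⟨j₀, rfl⟩ := hr
      have hkey : key j₀ ∈ B := hB _ List.mem_cons_self j₀ rfl
      have hiff : ∀ b, (∃ j, rung k j₀ = rung k j ∧ key j = b) ↔ key j₀ = b := by
        intro b
        constructor
        · rintro ⟨j, hj, rfl⟩
          rw [rung_injective k hj]
        · intro h
          exact ⟨j₀, rfl, h⟩
      have h1 : (if decide (IsKRung k (rung k j₀)) = true then 1 else 0) = 1 := by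
        simp [IsKRung]
      rw [h1]
      simp_rw [hiff, decide_eq_true_eq]
      rw [Finset.sum_ite_eq B (key j₀) (fun _ => (1 : ℕ)), if_pos hkey]
    · have h0 : (if decide (IsKRung k e) = true then 1 else 0) = 0 := by simp [hr]
      rw [h0]
      symm
      refine Finset.sum_eq_zero fun b _ => ?_
      have : ¬ ∃ j, e = rung k j ∧ key j = b := by
        rintro ⟨j, rfl, -⟩
        exact hr ⟨j, rfl⟩
      simp [this]

end

end Literature.Probability.LatticeModels.Mesh
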